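import Summits.BirchSwinnertonDyer.BirchSwinnertonDyer.Theorems.PlecticLegsKatoDescent
import HarnessLib
import Literature.NumberTheory.EllipticCurves.KatoTwistedFiniteness

/-!
# BirchSwinnertonDyer / PlecticLegs — support item `KatoDescent` (stmt-BirchSwinnertonDyer-18262):
# the item modulo named facts

`PlecticLegsKatoDescent` proves the route item `KatoDescent` from a curve-side form of Kato's
Cor. 14.3 (2) over `K = ℚ(ζ_m)` for every `m ≥ 1`. The tree's vendored form of that corollary,
`Literature.NumberTheory.EllipticCurves.kato_finite_chiPart_of_twistedLValue_ne_zero`, is stated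
for the newform `f` of `E` and only for `m ≢ 2 (mod 4)` (least modulus of `ℚ(ζ_m)`), which does
not cover the item as filed (all `m`). This file records the exact named input under which the
item closes:

* `kato_finite_chiPart_cyclotomic_of_twistedLValue_ne_zero` — Kato, Astérisque 295, Cor. 14.3 (2)
  for `A = E` (newform `f`, `IsNewformOf W f`), `K = ℚ(ζ_m)` for EVERY `m ≥ 1`, with the
  non-vanishing hypothesis placed on (an entire continuation of) the mod-`m` twisted series
  `twistedLSeries f χ = ∑ χ(n) aₙ(f) n⁻ˢ = L_{prime(m)}(f, χ, s)`; for `m ≢ 2 (mod 4)` this is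
  literally the vendored fact, and for `m ≡ 2 (mod 4)` Kato's `L_{prime(m/2)}(f, χ, s)` differs
  from `L_{prime(m)}` by the Euler factor at the unramified prime `2`, an entire polynomial in
  `2⁻ˢ`, so `L_{prime(m)}(f, χ, 1) ≠ 0` implies Kato's hypothesis `L(A, χ, 1) ≠ 0`;
* `kato_finite_chiPart_of_cyclotomic` — the new statement implies the vendored one;
* `plecticLegs_katoDescent_of_kato` — **`exists_isNewformOf → (the fact) → KatoDescent`**:
  the item holds modulo modularity (Breuil–Conrad–Diamond–Taylor 2001, Thm. A, tree fact
  `exists_isNewformOf`) and Kato's Cor. 14.3 (2).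

All names below are fully qualified (no file-level `open`), so that the named fact can be
relocated verbatim by the gate.
-/

set_option linter.dupNamespace false

noncomputable section

namespace Summit.BirchSwinnertonDyer.BirchSwinnertonDyer.Theorems

open scoped Classical in
/-- The all-moduli statement `kato_finite_chiPart_cyclotomic_of_twistedLValue_ne_zero` contains
the tree's vendored one (`m ≢ 2 (mod 4)`), by discarding the congruence condition. [folklore] -/
theorem kato_finite_chiPart_of_cyclotomic
    (hK : Literature.NumberTheory.EllipticCurves.kato_finite_chiPart_cyclotomic_of_twistedLValue_ne_zero) :
    Literature.NumberTheory.EllipticCurves.kato_finite_chiPart_of_twistedLValue_ne_zero :=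
  fun W _ _ _ _ hf _ _ _ χ hL => hK W hf χ hL

open scoped Classical in
/-- **The item `KatoDescent` modulo named facts**: modularity (`exists_isNewformOf`, BCDT 2001
Thm. A: `aₙ(f) = aₙ(E)`) identifies the curve-side twisted series of the route with
`twistedLSeries f χ`, and Kato's Cor. 14.3 (2) over `ℚ(ζ_m)`
(`kato_finite_chiPart_cyclotomic_of_twistedLValue_ne_zero`) then supplies the finiteness of the
`χ`-parts consumed by `plecticLegs_katoDescent_of_finite_chiPart`. The instance
`NeZero (N_E)` required by `exists_isNewformOf` is the tree theorem
`WeierstrassCurve.conductorNorm_pos_holds`. [cite: Kato2004Asterisque, Cor. 14.3 (2) (p. 235)] -/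
theorem plecticLegs_katoDescent_of_kato
    (hmod : Literature.NumberTheory.EllipticCurves.ModularForms.exists_isNewformOf)
    (hK : Literature.NumberTheory.EllipticCurves.kato_finite_chiPart_cyclotomic_of_twistedLValue_ne_zero) :
    Summit.BirchSwinnertonDyer.BirchSwinnertonDyer.Theses.PlecticLegs.KatoDescent :=
  plecticLegs_katoDescent_of_finite_chiPart fun W _ m _ χ hL => by
    haveI : NeZero (W.conductorNorm ℤ) := ⟨(W.conductorNorm_pos_holds).ne'⟩
    obtain ⟨f, hf⟩ := hmod W
    refine hK W hf χ ?_
    obtain ⟨L, hLd, hLs, hL1⟩ := hL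
    refine ⟨L, hLd, fun s hs => ?_, hL1⟩
    rw [hLs s hs, Literature.NumberTheory.EllipticCurves.ModularForms.twistedLSeries]
    congr 1
    funext n
    rw [hf.2 n]

end Summit.BirchSwinnertonDyer.BirchSwinnertonDyer.Theorems

end
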